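import Mathlib
import HarnessLib

/-!
# Route `KLProgramme` — K3 engine (stmt-HubbardSuperconductivity-20437), stub (b) (ℓ)/(I2)–(I3), located item «ABS-UMK-COUNT» / «UV-REMEASURE-COUNT»:
# lattice points in thin level sets, part 6 — the GRAPH CHART BY INVERSE FUNCTION (one variable)

Cell gate-hubbard-kl, seat p4 g15 (model layer of the route HOME/prover-p4/UV-REMEASURE-COUNT.md §5, generic half).  The pair count
`card_mul_sq_le_tripleSum_local` (part 5) consumes a GRAPH function `f` (tangential coordinate `u ↦` normal displacement `f(u)`) with
`Measurable f`, `HasDerivAt f / f′` on a closed interval and `c ≤ f″ ≤ A`, `|f′| ≤ B` there.  A parametrised plane curve near a base point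
gives instead two coordinate functions of the curve parameter, `U` (tangential) and `V` (normal), with `U′ ≥ m > 0` on a parameter window
`[−Φ, Φ]`.  This file performs the reparametrisation `f = V ∘ U⁻¹` once and for all, by elementary means (no inverse function theorem beyond
Mathlib's `HasDerivAt.of_local_left_inverse`): `U` is extended off `[−Φ, Φ]` to a strictly increasing continuous surjection of `ℝ`
(`x ↦ U(clamp x) + m·(x − clamp x)`), inverted as an order isomorphism, and `f, f′, f″` are read off through the clamp:

* `mul_sub_le_sub_of_hasDerivAt_ge` / `abs_sub_le_mul_abs_sub_of_hasDerivAt_le` — the two Lipschitz directions of `U` on `[−Φ, Φ]`;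
* **`exists_inverse_graph`** — `∃ f f′ f″`, `f` measurable, with `f(U x) = V x`, `f′(U x) = V′x/U′x`, `f″(U x) = (V″U′ − V′U″)(x)/U′(x)³` for
  `x ∈ [−Φ, Φ]`; every `y ∈ [U(−Φ), U(Φ)]` is `U x` for some `x ∈ [−Φ, Φ]` at which these three identities hold; and
  `HasDerivAt f (f′ y) y`, `HasDerivAt f′ (f″ y) y` at every `y` of the OPEN image interval `(U(−Φ), U(Φ))`.

Bounds on `f′, f″` over the image interval then follow from bounds on `U′, U″, V′, V″` over `[−Φ, Φ]` (part 7 does this for polar curves).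
Everything is PROVED; no definitions, no named facts; generic calculus. [folklore]
-/

noncomputable section

open Real Set Filter Topology

namespace Summit.HubbardSuperconductivity.HubbardSuperconductivity.Theorems.ThinLevelSet

set_option linter.dupNamespace false -- summit = problem name (single-conjunct summit), D-0017

/-! ## §1 The two Lipschitz directions of a function with derivative bounds on a closed interval -/

/-- Lower Lipschitz bound: `HasDerivAt U (U′ x) x` and `m ≤ U′ x` on `[a, b]` give `m·(y − x) ≤ U y − U x` for `a ≤ x ≤ y ≤ b`
(mean value theorem). [folklore] -/
theorem mul_sub_le_sub_of_hasDerivAt_ge {U U' : ℝ → ℝ} {a b m : ℝ}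
    (hU : ∀ x ∈ Icc a b, HasDerivAt U (U' x) x) (hm : ∀ x ∈ Icc a b, m ≤ U' x) :
    ∀ x ∈ Icc a b, ∀ y ∈ Icc a b, x ≤ y → m * (y - x) ≤ U y - U x := by
  have hcont : ContinuousOn U (Icc a b) := fun x hx => (hU x hx).continuousAt.continuousWithinAt
  have hdiff : DifferentiableOn ℝ U (interior (Icc a b)) :=
    fun x hx => (hU x (interior_subset hx)).differentiableAt.differentiableWithinAt
  have hder : ∀ x ∈ interior (Icc a b), m ≤ deriv U x := fun x hx => by
    rw [(hU x (interior_subset hx)).deriv]; exact hm x (interior_subset hx)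
  exact (convex_Icc a b).mul_sub_le_image_sub_of_le_deriv hcont hdiff hder

/-- Upper Lipschitz bound: `HasDerivAt U (U′ x) x` and `|U′ x| ≤ M` on `[a, b]` give `|U y − U x| ≤ M·|y − x|` on `[a, b]`
(mean value inequality). [folklore] -/
theorem abs_sub_le_mul_abs_sub_of_hasDerivAt_le {U U' : ℝ → ℝ} {a b M : ℝ}
    (hU : ∀ x ∈ Icc a b, HasDerivAt U (U' x) x) (hM : ∀ x ∈ Icc a b, |U' x| ≤ M) :
    ∀ x ∈ Icc a b, ∀ y ∈ Icc a b, |U y - U x| ≤ M * |y - x| := by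
  intro x hx y hy
  have hderW : ∀ z ∈ Icc a b, HasDerivWithinAt U (U' z) (Icc a b) z := fun z hz => (hU z hz).hasDerivWithinAt
  have hbound : ∀ z ∈ Icc a b, ‖U' z‖ ≤ M := fun z hz => by rw [Real.norm_eq_abs]; exact hM z hz
  have h := (convex_Icc a b).norm_image_sub_le_of_norm_hasDerivWithin_le hderW hbound hx hy
  rw [Real.norm_eq_abs, Real.norm_eq_abs] at h
  exact h

/-! ## §2 The inverse-function graph chart -/

/-- **Graph chart by inverse function.**  Let `U, V : ℝ → ℝ` have derivatives `U′, V′` and second derivatives `U″, V″` at every point of `[−Φ, Φ]`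
(`Φ > 0`), with `U′ ≥ m > 0` there.  Then there are `f, f′, f″ : ℝ → ℝ` with `f` measurable such that
(i) `f(U x) = V x`, `f′(U x) = V′ x / U′ x`, `f″(U x) = (V″ x·U′ x − V′ x·U″ x)/(U′ x)³` for every `x ∈ [−Φ, Φ]`;
(ii) every `y ∈ [U(−Φ), U(Φ)]` equals `U x` for some `x ∈ [−Φ, Φ]` at which the identities (i) hold (so bounds transfer to the image interval);
(iii) `HasDerivAt f (f′ y) y` and `HasDerivAt f′ (f″ y) y` for every `y ∈ (U(−Φ), U(Φ))`.
Construction: `f = V ∘ clamp ∘ Ũ⁻¹` with `Ũ x = U(clamp x) + m(x − clamp x)` a strictly increasing continuous surjection. [folklore] -/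
theorem exists_inverse_graph {U U' U'' V V' V'' : ℝ → ℝ} {Φ m : ℝ} (hΦ : 0 < Φ) (hm : 0 < m)
    (hU : ∀ x ∈ Icc (-Φ) Φ, HasDerivAt U (U' x) x) (hU' : ∀ x ∈ Icc (-Φ) Φ, HasDerivAt U' (U'' x) x)
    (hV : ∀ x ∈ Icc (-Φ) Φ, HasDerivAt V (V' x) x) (hV' : ∀ x ∈ Icc (-Φ) Φ, HasDerivAt V' (V'' x) x)
    (hm' : ∀ x ∈ Icc (-Φ) Φ, m ≤ U' x) :
    ∃ f f' f'' : ℝ → ℝ, Measurable f ∧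
      (∀ x ∈ Icc (-Φ) Φ, f (U x) = V x ∧ f' (U x) = V' x / U' x ∧
        f'' (U x) = (V'' x * U' x - V' x * U'' x) / U' x ^ 3) ∧
      (∀ y ∈ Icc (U (-Φ)) (U Φ), ∃ x ∈ Icc (-Φ) Φ, U x = y ∧ f y = V x ∧ f' y = V' x / U' x ∧
        f'' y = (V'' x * U' x - V' x * U'' x) / U' x ^ 3) ∧
      (∀ y ∈ Ioo (U (-Φ)) (U Φ), HasDerivAt f (f' y) y ∧ HasDerivAt f' (f'' y) y) := by
  -- the clamp onto `[−Φ, Φ]`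
  set c : ℝ → ℝ := fun x => max (-Φ) (min x Φ) with hc
  have hc_mem : ∀ x, c x ∈ Icc (-Φ) Φ := fun x =>
    ⟨le_max_left _ _, max_le (by linarith) (min_le_right _ _)⟩
  have hc_id : ∀ x ∈ Icc (-Φ) Φ, c x = x := fun x hx => by
    rw [hc]; simp only; rw [min_eq_left hx.2, max_eq_right hx.1]
  have hc_mono : Monotone c := fun x y hxy => max_le_max le_rfl (min_le_min hxy le_rfl)
  have hc_cont : Continuous c := continuous_const.max (continuous_id.min continuous_const)
  -- continuity of `U`, `V`, `V′/U′` data on the interval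
  have hUcont : ContinuousOn U (Icc (-Φ) Φ) := fun x hx => (hU x hx).continuousAt.continuousWithinAt
  have hVcont : ContinuousOn V (Icc (-Φ) Φ) := fun x hx => (hV x hx).continuousAt.continuousWithinAt
  have hMVT := mul_sub_le_sub_of_hasDerivAt_ge hU hm'
  -- the extension `Ũ`
  set Ut : ℝ → ℝ := fun x => U (c x) + m * (x - c x) with hUt
  have hUt_eq : ∀ x ∈ Icc (-Φ) Φ, Ut x = U x := fun x hx => by
    rw [hUt]; simp only; rw [hc_id x hx, sub_self, mul_zero, add_zero]
  have hlin : ∀ x y, x ≤ y → m * (y - x) ≤ Ut y - Ut x := by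
    intro x y hxy
    have h1 := hMVT (c x) (hc_mem x) (c y) (hc_mem y) (hc_mono hxy)
    rw [hUt]; simp only
    nlinarith [h1]
  have hmono : StrictMono Ut := by
    intro x y hxy
    have h1 := hlin x y hxy.le
    have h2 : 0 < m * (y - x) := mul_pos hm (sub_pos.2 hxy)
    linarith
  have hUt_cont : Continuous Ut := by
    have h1 : Continuous (fun x => U (c x)) := hUcont.comp_continuous hc_cont hc_mem
    exact h1.add (continuous_const.mul (continuous_id.sub hc_cont))
  have htop : Tendsto Ut atTop atTop := by
    have h1 : Tendsto (fun x : ℝ => Ut 0 + m * x) atTop atTop :=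
      tendsto_const_nhds.add_atTop (tendsto_id.const_mul_atTop hm)
    refine tendsto_atTop_mono' atTop ?_ h1
    filter_upwards [eventually_ge_atTop (0 : ℝ)] with x hx
    have := hlin 0 x hx
    linarith
  have hbot : Tendsto Ut atBot atBot := by
    have h1 : Tendsto (fun x : ℝ => Ut 0 + m * x) atBot atBot :=
      tendsto_const_nhds.add_atBot (tendsto_id.const_mul_atBot hm)
    refine tendsto_atBot_mono' atBot ?_ h1
    filter_upwards [eventually_le_atBot (0 : ℝ)] with x hx
    have := hlin x 0 hx
    linarith
  have hsurj : Function.Surjective Ut := hUt_cont.surjective htop hbot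
  -- the inverse as an order isomorphism
  set e : ℝ ≃o ℝ := hmono.orderIsoOfSurjective Ut hsurj with he
  set g : ℝ → ℝ := fun y => e.symm y with hg
  have hg_cont : Continuous g := e.symm.continuous
  have hg_mono : Monotone g := e.symm.monotone
  have hg_smono : StrictMono g := e.symm.strictMono
  have hUg : ∀ y, Ut (g y) = y := fun y => hmono.orderIsoOfSurjective_self_symm_apply Ut hsurj y
  have hgU : ∀ x, g (Ut x) = x := fun x => hmono.orderIsoOfSurjective_symm_apply_self Ut hsurj x
  have hgU' : ∀ x ∈ Icc (-Φ) Φ, g (U x) = x := fun x hx => by rw [← hUt_eq x hx]; exact hgU x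
  -- the chart functions
  set f : ℝ → ℝ := fun y => V (c (g y)) with hf
  set f' : ℝ → ℝ := fun y => V' (c (g y)) / U' (c (g y)) with hf'
  set f'' : ℝ → ℝ := fun y => (V'' (c (g y)) * U' (c (g y)) - V' (c (g y)) * U'' (c (g y))) / U' (c (g y)) ^ 3 with hf''
  have hf_cont : Continuous f := hVcont.comp_continuous (hc_cont.comp hg_cont) fun y => hc_mem _
  refine ⟨f, f', f'', hf_cont.measurable, ?_, ?_, ?_⟩
  · -- (i) values on the chart
    intro x hx
    have hcg : c (g (U x)) = x := by rw [hgU' x hx, hc_id x hx]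
    refine ⟨?_, ?_, ?_⟩
    · rw [hf]; simp only; rw [hcg]
    · rw [hf']; simp only; rw [hcg]
    · rw [hf'']; simp only; rw [hcg]
  · -- (ii) the closed image interval
    intro y hy
    have hΦm : -Φ ∈ Icc (-Φ) Φ := ⟨le_rfl, by linarith⟩
    have hΦp : Φ ∈ Icc (-Φ) Φ := ⟨by linarith, le_rfl⟩
    have hgy : g y ∈ Icc (-Φ) Φ := by
      constructor
      · have := hg_mono hy.1; rwa [hgU' _ hΦm] at this
      · have := hg_mono hy.2; rwa [hgU' _ hΦp] at this
    have hcgy : c (g y) = g y := hc_id _ hgy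
    have hUy : U (g y) = y := by rw [← hUt_eq _ hgy]; exact hUg y
    refine ⟨g y, hgy, hUy, ?_, ?_, ?_⟩
    · rw [hf]; simp only; rw [hcgy]
    · rw [hf']; simp only; rw [hcgy]
    · rw [hf'']; simp only; rw [hcgy]
  · -- (iii) derivatives on the open image interval
    intro y hy
    have hΦm : -Φ ∈ Icc (-Φ) Φ := ⟨le_rfl, by linarith⟩
    have hΦp : Φ ∈ Icc (-Φ) Φ := ⟨by linarith, le_rfl⟩
    set x₀ := g y with hx₀
    have hx₀o : x₀ ∈ Ioo (-Φ) Φ := by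
      constructor
      · have := hg_smono hy.1; rwa [hgU' _ hΦm] at this
      · have := hg_smono hy.2; rwa [hgU' _ hΦp] at this
    have hx₀c : x₀ ∈ Icc (-Φ) Φ := Ioo_subset_Icc_self hx₀o
    have hU'pos : 0 < U' x₀ := hm.trans_le (hm' x₀ hx₀c)
    have hU'ne : U' x₀ ≠ 0 := hU'pos.ne'
    -- `Ũ = U` near `x₀`, so `Ũ` is differentiable there with derivative `U′ x₀`
    have hnx : ∀ᶠ x in 𝓝 x₀, x ∈ Ioo (-Φ) Φ := Ioo_mem_nhds hx₀o.1 hx₀o.2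
    have hUt_ev : Ut =ᶠ[𝓝 x₀] U := hnx.mono fun x hx => hUt_eq x (Ioo_subset_Icc_self hx)
    have hUt_der : HasDerivAt Ut (U' x₀) x₀ := (hU x₀ hx₀c).congr_of_eventuallyEq hUt_ev
    -- the inverse is differentiable at `y`
    have hg_der : HasDerivAt g (U' x₀)⁻¹ y :=
      HasDerivAt.of_local_left_inverse hg_cont.continuousAt hUt_der hU'ne (Eventually.of_forall hUg)
    -- near `y` the clamp is inactive
    have hny : ∀ᶠ y' in 𝓝 y, g y' ∈ Ioo (-Φ) Φ := hg_cont.continuousAt.eventually_mem (Ioo_mem_nhds hx₀o.1 hx₀o.2)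
    have hcg_ev : ∀ᶠ y' in 𝓝 y, c (g y') = g y' := hny.mono fun y' hy' => hc_id _ (Ioo_subset_Icc_self hy')
    have hcg : c (g y) = x₀ := hc_id _ hx₀c
    constructor
    · -- first derivative: `f = V ∘ g` near `y`
      have h1 : HasDerivAt (fun y' => V (g y')) (V' x₀ * (U' x₀)⁻¹) y := (hV x₀ hx₀c).comp y hg_der
      have h2 : f =ᶠ[𝓝 y] fun y' => V (g y') := hcg_ev.mono fun y' hy' => by rw [hf]; simp only; rw [hy']
      have h3 : HasDerivAt f (V' x₀ * (U' x₀)⁻¹) y := h1.congr_of_eventuallyEq h2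
      have h4 : f' y = V' x₀ * (U' x₀)⁻¹ := by rw [hf']; simp only; rw [hcg, div_eq_mul_inv]
      rw [h4]; exact h3
    · -- second derivative: `f′ = (V′/U′) ∘ g` near `y`
      have hq : HasDerivAt (fun x => V' x / U' x) ((V'' x₀ * U' x₀ - V' x₀ * U'' x₀) / U' x₀ ^ 2) x₀ :=
        (hV' x₀ hx₀c).div (hU' x₀ hx₀c) hU'ne
      have h1 : HasDerivAt ((fun x => V' x / U' x) ∘ g)
          ((V'' x₀ * U' x₀ - V' x₀ * U'' x₀) / U' x₀ ^ 2 * (U' x₀)⁻¹) y := hq.comp y hg_der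
      have h2 : f' =ᶠ[𝓝 y] ((fun x => V' x / U' x) ∘ g) :=
        hcg_ev.mono fun y' hy' => by rw [hf']; simp only [Function.comp_apply]; rw [hy']
      have h3 : HasDerivAt f' ((V'' x₀ * U' x₀ - V' x₀ * U'' x₀) / U' x₀ ^ 2 * (U' x₀)⁻¹) y :=
        h1.congr_of_eventuallyEq h2
      have h4 : f'' y = (V'' x₀ * U' x₀ - V' x₀ * U'' x₀) / U' x₀ ^ 2 * (U' x₀)⁻¹ := by
        rw [hf'']; simp only; rw [hcg]
        field_simp
      rw [h4]; exact h3

end Summit.HubbardSuperconductivity.HubbardSuperconductivity.Theorems.ThinLevelSet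

end
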